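/-
Copyright (c) 2026 the pub-hodgecm-mathlib formalisation cell (harness21).  Prover seat hodgecm-mathlib-F0P3a-p03 (g21): line LH7 (closer row `stub_PKtupleK2`, #181 III-127;
h413 = stmt-HodgeConjecture-24833), leaf ED. 3 road, the isotypy letter (O8b♭) at the finite places — FULL LOCAL ISOTYPY, BINDER-FREE; 2026-09-02.
-/
import Summits.HodgeConjecture.HodgeConjecture.Theorems.F0P3cPKtupleU2LocalIsotypy          -- ★ p850491 (this seat): `finRep_smoothPart_inclPlace_apply_eq_smul_of_realises₂_of_su` (binder `hSU`)
import Literature.NumberTheory.Automorphic.UnitaryGroupRankTwoNormOneGeneration              -- ★ p850502 (this seat): `UnitaryGroup.mk_mem_closure_isCompact_of_forall_det_eq_one` ((SU-GEN)_v, every `v`)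
import HarnessLib

/-!
# LH7 leaf ED. 3, (O8b♭) at the finite places — `Realises₂ P₂ ξ` ⇒ at EVERY finite place `v`, ALL of `U(Φ₂)(L⁺_v)` acts on the finite-adelic smooth vectors of `P₂` through `((η ψ) ∘ det) ∘ ι_v`
# ([Rogawski1990] §13.3 p. 203) — no unitarity, no weak approximation, no split ∕ non-split case in the statement

Cell `pub/hodgecm-mathlib` (D-0151), crux H413 = `stmt-HodgeConjecture-24833`, half A line LH7, leaf ED. 3 road (LH7-plan (g2) `MEMO-ED3.v2` §7 (c); census
`F0/P3a/F0P3a-p03/g20/CENSUS-O8b-PKmultOneU2.F0P3ap03g20.md`).  THEOREMS ONLY (kernel lane; no `def`, no instance, no notation, no named fact, no `sorry`).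
THIS FILE closes the LOCAL part (i) of the isotypy letter (O8b♭) in-house: ★ p850491 proved it modulo the group-theoretic input (SU-GEN)_v, and ★ p850502
`UnitaryGroup.mk_mem_closure_isCompact_of_forall_det_eq_one` proves (SU-GEN)_v at every finite place of a quadratic extension for `J = antidiag(1,1)` (split `v`: ★ Dickson ∘ ★ p850404 along
★ `localPiSplitEquiv`; non-split `v`: ★ p850490 `SU(1,1)` along ★ `localPiNonsplitEquiv`).  Here the two are composed at `(L⁺, L, complex conjugation, Φ₂)`.
* `forall_finRep_smoothPart_inclPlace_apply_eq_smul_of_realises₂` — `Realises₂ P₂ ξ ⇒ ∀ v, ∀ g ∈ U(Φ₂)(L⁺_v), ∀ f ∈ P₂^∞: P₂.finRep (inclPlace v g) f = (η ψ)(det (ι_v g)) • f`;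
* `forall_toContRep_inclPlaceAdelic_apply_eq_smul_of_realises₂` — the same on the `L²` vectors.
THE (O8b♭) LEDGER after this file (honest): (i) LOCAL — ★ (this file, every finite place, all of `U(Φ₂)(L⁺_v)`); (ii) places → `U(Φ₂)(𝔸_f)` (restricted-product generation + a.e.
unramifiedness of `(η ψ) ∘ det`) — L, in-house; (iii) the archimedean component — PRINT (weak approximation for `U(Φ₂)` at `∞`, [PlatonovRapinchuk1994] §7.3).  With (ii)+(iii) the letter
O8b `PKmultOneU2Shape L` follows from ★ p850173 `pkMultOneU2Shape_of_isotypy`.  HONEST LABEL: count-neutral; HC_CM is proved only modulo the 7 printed citations (2 remaining: hLiu418 =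
stmt-HodgeConjecture-24832, h413 = stmt-HodgeConjecture-24833) until rung 0 closes.

## References
* [Rogawski1990] J. D. Rogawski, *Automorphic Representations of Unitary Groups in Three Variables* (1990), §13.3 pp. 202–203 (`m(ξ) = 1`), §12.2 pp. 173–174, §1.9.
* [BushnellHenniart2006] C. J. Bushnell, G. Henniart, *The local Langlands conjecture for GL(2)* (2006), §2.3 Lemma, §7.2, §9.1.
* [PlatonovRapinchuk1994] V. Platonov, A. Rapinchuk, *Algebraic Groups and Number Theory* (1994), §3.3, §5.1, §7.1, §7.3.
-/

set_option autoImplicit false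
-- the mandated namespace repeats the single-problem summit's segment (`HodgeConjecture.HodgeConjecture`)
set_option linter.dupNamespace false

noncomputable section

namespace Summit.HodgeConjecture.HodgeConjecture.Cruxes.H413.F0P3cPKtupleU2LocalIsotypyFull

open MeasureTheory NumberField IsDedekindDomain
open Literature.NumberTheory Literature.NumberTheory.Automorphic Literature.NumberTheory.Automorphic.UnitaryGroup
open Literature.NumberTheory.Rogawski1990 Literature.NumberTheory.GaloisRepresentations
open Literature.NumberTheory.Automorphic.Arthur2013.Leaves.TECR
open Summit.HodgeConjecture.HodgeConjecture.Cruxes.H413.F0P3GlobalPacketDiscrete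
open Summit.HodgeConjecture.HodgeConjecture.Cruxes.H413.F0P3cPKtupleHSideLetters
open Summit.HodgeConjecture.HodgeConjecture.Cruxes.H413.F0P3cPKtupleU1Line
open Summit.HodgeConjecture.HodgeConjecture.Cruxes.H413.F0P3cPKtupleU2LocalIsotypy

variable {L : Type} [Field L] [NumberField L] [IsCMField L]

/-- **(SU-GEN) for `U(Φ₂)(L⁺_v)` at every finite place of the CM field `L`** (★ p850502 at `(L⁺, L, complex conjugation, Φ₂)`; ★ `IsCMField.isQuadraticExtension`, ★ `complexConj_ne_one`; `Φ₂ = !![0,1;1,0]` entrywise, cf. ★ `Rogawski1990.antidiagTwo_eq`):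
the `hSU` binder of ★ p850491, discharged. [cite: PlatonovRapinchuk1994, §3.3; §5.1; §7.1] [cite: Rogawski1990, §1.9] -/
theorem mk_mem_closure_isCompact_of_forall_det_eq_one (v : HeightOneSpectrum (𝓞 ↥(maximalRealSubfield L))) (u : LocalGLPi L 2 v) (hu : u ∈ localPi L (IsCMField.complexConj L) 2 (Matrix.of fun i j : Fin 2 => if i.val + j.val + 1 = 2 then (1 : L) else 0) v)
    (hdet : ∀ w : PlacesOver L v, ((u w : GL (Fin 2) (w.1.adicCompletion L)) : Matrix (Fin 2) (Fin 2) (w.1.adicCompletion L)).det = 1) :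
    (⟨u, hu⟩ : ↥(localPi L (IsCMField.complexConj L) 2 (Matrix.of fun i j : Fin 2 => if i.val + j.val + 1 = 2 then (1 : L) else 0) v)) ∈ Subgroup.closure (⋃ K ∈ {K : Subgroup ↥(localPi L (IsCMField.complexConj L) 2 (Matrix.of fun i j : Fin 2 => if i.val + j.val + 1 = 2 then (1 : L) else 0) v) | IsCompact (K : Set ↥(localPi L (IsCMField.complexConj L) 2 (Matrix.of fun i j : Fin 2 => if i.val + j.val + 1 = 2 then (1 : L) else 0) v))},
      (K : Set ↥(localPi L (IsCMField.complexConj L) 2 (Matrix.of fun i j : Fin 2 => if i.val + j.val + 1 = 2 then (1 : L) else 0) v))) := by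
  haveI : Algebra.IsQuadraticExtension ↥(maximalRealSubfield L) L := IsCMField.isQuadraticExtension L
  exact UnitaryGroup.mk_mem_closure_isCompact_of_forall_det_eq_one L (IsCMField.complexConj L) (IsCMField.complexConj_ne_one L)
    (by ext i j; fin_cases i <;> fin_cases j <;> rfl) v u hu hdet

/-- **FULL LOCAL ISOTYPY AT EVERY FINITE PLACE (binder-free).**  Let `P₂` be a discrete automorphic representation of `U(Φ₂)` with `Realises₂ P₂ ξ`.  Then for EVERY finite place `v`, EVERY
`g ∈ U(Φ₂)(L⁺_v)` (Π-model ★ `localPi … v`) and every `U(Φ₂)(𝔸_f)`-smooth vector `f` of `P₂`: `P₂.finRep (inclPlace v g) f = (η ψ)(det (ι_v g)) • f` — ★ p850491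
`finRep_smoothPart_inclPlace_apply_eq_smul_of_realises₂_of_su` with (SU-GEN)_v discharged by `mk_mem_closure_isCompact_of_forall_det_eq_one`.  The local part (i) of the isotypy letter (O8b♭),
in-house and unconditional. [cite: Rogawski1990, §13.3 p. 203] [cite: BushnellHenniart2006, §2.3 Lemma; §9.1] -/
theorem forall_finRep_smoothPart_inclPlace_apply_eq_smul_of_realises₂
    {μ₂ : Measure (adelicGroupData ↥(maximalRealSubfield L) L (IsCMField.complexConj L) 2 (Matrix.of fun i j : Fin 2 => if i.val + j.val + 1 = 2 then (1 : L) else 0)).automorphicQuotient}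
    [(adelicGroupData ↥(maximalRealSubfield L) L (IsCMField.complexConj L) 2 (Matrix.of fun i j : Fin 2 => if i.val + j.val + 1 = 2 then (1 : L) else 0)).IsAutomorphicMeasure μ₂]
    (P₂ : DiscreteAutomorphicRep (adelicGroupData ↥(maximalRealSubfield L) L (IsCMField.complexConj L) 2 (Matrix.of fun i j : Fin 2 => if i.val + j.val + 1 = 2 then (1 : L) else 0)) μ₂) (ξ : OneDimAutRepH L)
    (h : Realises₂ P₂ ξ) (v : HeightOneSpectrum (𝓞 ↥(maximalRealSubfield L)))
    (g : ↥(localPi L (IsCMField.complexConj L) 2 (Matrix.of fun i j : Fin 2 => if i.val + j.val + 1 = 2 then (1 : L) else 0) v)) (f : ↥P₂.finRep.smoothPart.toSubmodule) :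
    P₂.finRep.smoothPart.toRepresentation (inclPlace ↥(maximalRealSubfield L) L (IsCMField.complexConj L) 2 (Matrix.of fun i j : Fin 2 => if i.val + j.val + 1 = 2 then (1 : L) else 0) v g) f =
      (((cmDetChar L 2 (Matrix.of fun i j : Fin 2 => if i.val + j.val + 1 = 2 then (1 : L) else 0) (ξ.η * ξ.ψ) (isAutomorphic_eta_mul_psi ξ) (isUnit_antidiagOne_det L 2).ne_zero)
        (inclPlaceAdelic ↥(maximalRealSubfield L) L (IsCMField.complexConj L) 2 (Matrix.of fun i j : Fin 2 => if i.val + j.val + 1 = 2 then (1 : L) else 0) v g) : ℂˣ) : ℂ) • f :=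
  finRep_smoothPart_inclPlace_apply_eq_smul_of_realises₂_of_su P₂ ξ h v (mk_mem_closure_isCompact_of_forall_det_eq_one v) g f

/-- **The same on the underlying `L²` vectors**: under `Realises₂ P₂ ξ`, for every finite `v`, every `g ∈ U(Φ₂)(L⁺_v)` and every `U(Φ₂)(𝔸_f)`-smooth `f ∈ P₂`,
`R(ι_v g) f = (η ψ)(det (ι_v g)) • f` in `L²(U(Φ₂)(L⁺) \ U(Φ₂)(𝔸))`. [cite: Rogawski1990, §13.3 p. 203] [cite: BushnellHenniart2006, §2.3 Lemma; §9.1] -/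
theorem forall_toContRep_inclPlaceAdelic_apply_eq_smul_of_realises₂
    {μ₂ : Measure (adelicGroupData ↥(maximalRealSubfield L) L (IsCMField.complexConj L) 2 (Matrix.of fun i j : Fin 2 => if i.val + j.val + 1 = 2 then (1 : L) else 0)).automorphicQuotient}
    [(adelicGroupData ↥(maximalRealSubfield L) L (IsCMField.complexConj L) 2 (Matrix.of fun i j : Fin 2 => if i.val + j.val + 1 = 2 then (1 : L) else 0)).IsAutomorphicMeasure μ₂]
    (P₂ : DiscreteAutomorphicRep (adelicGroupData ↥(maximalRealSubfield L) L (IsCMField.complexConj L) 2 (Matrix.of fun i j : Fin 2 => if i.val + j.val + 1 = 2 then (1 : L) else 0)) μ₂) (ξ : OneDimAutRepH L)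
    (h : Realises₂ P₂ ξ) (v : HeightOneSpectrum (𝓞 ↥(maximalRealSubfield L)))
    (g : ↥(localPi L (IsCMField.complexConj L) 2 (Matrix.of fun i j : Fin 2 => if i.val + j.val + 1 = 2 then (1 : L) else 0) v)) (f : ↥P₂.space.toSubmodule) (hf : f ∈ P₂.finRep.smoothPart) :
    P₂.space.toContRep (inclPlaceAdelic ↥(maximalRealSubfield L) L (IsCMField.complexConj L) 2 (Matrix.of fun i j : Fin 2 => if i.val + j.val + 1 = 2 then (1 : L) else 0) v g) f =
      (((cmDetChar L 2 (Matrix.of fun i j : Fin 2 => if i.val + j.val + 1 = 2 then (1 : L) else 0) (ξ.η * ξ.ψ) (isAutomorphic_eta_mul_psi ξ) (isUnit_antidiagOne_det L 2).ne_zero)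
        (inclPlaceAdelic ↥(maximalRealSubfield L) L (IsCMField.complexConj L) 2 (Matrix.of fun i j : Fin 2 => if i.val + j.val + 1 = 2 then (1 : L) else 0) v g) : ℂˣ) : ℂ) • f :=
  congrArg Subtype.val (forall_finRep_smoothPart_inclPlace_apply_eq_smul_of_realises₂ P₂ ξ h v g ⟨f, hf⟩)

end Summit.HodgeConjecture.HodgeConjecture.Cruxes.H413.F0P3cPKtupleU2LocalIsotypyFull

end
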